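import Literature.Computability.AlgebraicComplexity.BI17LatinAnnuliProofs
import HarnessLib

/-!
# BI 2017, Rem. 3.26 — the symbol-relabelling symmetry of the signed Latin annulus count

Bürgisser–Ikenmeyer 2017, Rem. 3.26 reduces the two remaining numerical verifications of
`BI2017_rem_3_26` ("We verified that [the number of even `m × (m+1)` Latin Annuli differs from
the number of odd ones] for `m = 1, 3, 5,` and `7`") to the signed counts
`latinAnnulusCount 5 6 ≠ 0` and `latinAnnulusCount 7 8 ≠ 0`
(`BI2017_rem_3_26_of_counts`, `BI17LatinAnnuliProofs.lean`).  This file proves the first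
reduction step of any kernel evaluation of these counts: relabelling the symbols of a Latin
annulus by a permutation `π ∈ 𝔖_m` is a bijection of the set of `m × d` Latin annuli which
multiplies the column-sign by `sgn(π)^d`; hence for EVEN `d` the signed count is `m!` times the
signed count of the annuli whose column `0` is the identity (`latinAnnulusCount_eq_factorial_mul`,
in the column-permutation parametrisation of `latinAnnulusCount_eq_sum_perm`).  For the case
`m = 5, d = 6` of Rem. 3.26 this gives `latinAnnulusCount 5 6 = 120 · N₅` with `N₅` the signed count
of the normalised `5 × 6` Latin annuli (`latinAnnulusCount_five_six_eq`); a native enumeration gives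
`N₅ = 2304` over `9408` normalised annuli (`latinAnnulusCount 5 6 = 276480`), whose kernel
certification is left to a pruned cell-level enumeration.

## References
* [BurgisserIkenmeyer2017] P. Bürgisser, C. Ikenmeyer, Fundamental invariants of orbit closures,
  J. Algebra 477 (2017) 390–434, Rem. 3.26.
-/

open Equiv

namespace Literature.Computability.AlgebraicComplexity

section RelabellingSymmetry

variable {m d : ℕ}

/-- Relabelling the symbols of a tuple of column permutations by `π` (left multiplication in every
column) does not change whether all diagonals are bijective. [cite: BurgisserIkenmeyer2017, Rem. 3.26] -/
theorem latinAnnulus_diagBijective_mul_iff (π : Perm (Fin m)) (σ : Fin d → Perm (Fin m)) :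
    (∀ i : Fin d, Function.Bijective fun κ : Fin m =>
        (π * σ ⟨((i : ℕ) + (κ : ℕ)) % d, Nat.mod_lt _ i.pos⟩) κ) ↔
      ∀ i : Fin d, Function.Bijective fun κ : Fin m =>
        σ ⟨((i : ℕ) + (κ : ℕ)) % d, Nat.mod_lt _ i.pos⟩ κ := by
  refine forall_congr' fun i => ?_
  exact π.bijective.of_comp_iff' _

/-- Relabelling the symbols by `π` multiplies the product of the column signs by `sgn(π)^d`.
[cite: BurgisserIkenmeyer2017, Rem. 3.26] -/
theorem prod_seqSign_mul (π : Perm (Fin m)) (σ : Fin d → Perm (Fin m)) :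
    ∏ j, ((Kumar2015.seqSign (⇑(π * σ j)) : ℤˣ) : ℤ) =
      ((Perm.sign π : ℤˣ) : ℤ) ^ d * ∏ j, ((Kumar2015.seqSign (⇑(σ j)) : ℤˣ) : ℤ) := by
  simp only [Kumar2015.seqSign_coe_perm, Perm.sign_mul, Units.val_mul]
  rw [Finset.prod_mul_distrib, Finset.prod_const, Finset.card_univ, Fintype.card_fin]

/-- For even `d` the relabelling leaves the product of the column signs unchanged.
[cite: BurgisserIkenmeyer2017, Rem. 3.26] -/
theorem prod_seqSign_mul_of_even (hd : Even d) (π : Perm (Fin m)) (σ : Fin d → Perm (Fin m)) :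
    ∏ j, ((Kumar2015.seqSign (⇑(π * σ j)) : ℤˣ) : ℤ) =
      ∏ j, ((Kumar2015.seqSign (⇑(σ j)) : ℤˣ) : ℤ) := by
  rw [prod_seqSign_mul]
  obtain ⟨k, rfl⟩ := hd
  have h1 : ((Perm.sign π : ℤˣ) : ℤ) ^ (k + k) = 1 := by
    rw [pow_add, ← mul_pow, ← Units.val_mul, Int.units_mul_self, Units.val_one, one_pow]
  rw [h1, one_mul]

/-- The relabelling equivalence: a tuple of column permutations is the same as a relabelling
permutation (its column `0`) together with a tuple whose column `0` is the identity.
[cite: BurgisserIkenmeyer2017, Rem. 3.26] -/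
theorem relabelEquiv_aux [NeZero d] (σ : Fin d → Perm (Fin m)) :
    (fun j => (σ 0)⁻¹ * σ j) 0 = 1 := by
  simp

/-- **Symbol-relabelling symmetry of the signed Latin annulus count** (BI 2017 Rem. 3.26, first
reduction step of the verification "for `m = 1, 3, 5, 7`"): for even `d`, the signed count of
`m × d` Latin annuli is `m!` times the signed count of those whose column `0` is the identity
permutation (relabelling the symbols by `π ∈ 𝔖_m` is a bijection on Latin annuli multiplying the
column-sign by `sgn(π)^d = 1`). Stated in the column-permutation parametrisation of
`latinAnnulusCount_eq_sum_perm`. [cite: BurgisserIkenmeyer2017, Rem. 3.26] -/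
theorem latinAnnulusCount_eq_factorial_mul (m d : ℕ) [NeZero d] (hd : Even d) :
    latinAnnulusCount m d =
      (m.factorial : ℤ) *
        ∑ σ ∈ (Finset.univ : Finset (Fin d → Perm (Fin m))).filter (fun σ => σ 0 = 1),
          if ∀ i : Fin d, Function.Bijective fun κ : Fin m =>
              σ ⟨((i : ℕ) + (κ : ℕ)) % d, Nat.mod_lt _ i.pos⟩ κ
          then ∏ j, ((Kumar2015.seqSign (⇑(σ j)) : ℤˣ) : ℤ) else 0 := by
  classical
  rw [latinAnnulusCount_eq_sum_perm]
  -- the summand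
  set f : (Fin d → Perm (Fin m)) → ℤ := fun σ =>
    if ∀ i : Fin d, Function.Bijective fun κ : Fin m =>
        σ ⟨((i : ℕ) + (κ : ℕ)) % d, Nat.mod_lt _ i.pos⟩ κ
    then ∏ j, ((Kumar2015.seqSign (⇑(σ j)) : ℤˣ) : ℤ) else 0 with hf
  -- invariance of the summand under relabelling
  have hinv : ∀ (π : Perm (Fin m)) (σ : Fin d → Perm (Fin m)), f (fun j => π * σ j) = f σ := by
    intro π σ
    simp only [hf]
    rw [prod_seqSign_mul_of_even hd π σ]
    by_cases hB : ∀ i : Fin d, Function.Bijective fun κ : Fin m =>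
        σ ⟨((i : ℕ) + (κ : ℕ)) % d, Nat.mod_lt _ i.pos⟩ κ
    · rw [if_pos hB, if_pos ((latinAnnulus_diagBijective_mul_iff π σ).mpr hB)]
    · rw [if_neg hB, if_neg (fun h => hB ((latinAnnulus_diagBijective_mul_iff π σ).mp h))]
  -- the relabelling bijection `(π, τ) ↦ (j ↦ π * τ j)`
  let e : Perm (Fin m) × {τ : Fin d → Perm (Fin m) // τ 0 = 1} ≃ (Fin d → Perm (Fin m)) :=
    { toFun := fun p => fun j => p.1 * p.2.1 j
      invFun := fun σ => (σ 0, ⟨fun j => (σ 0)⁻¹ * σ j, by simp⟩)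
      left_inv := by
        rintro ⟨π, τ, hτ⟩
        ext j x
        · simp [hτ]
        · simp [hτ]
      right_inv := by
        intro σ
        funext j
        simp }
  rw [← Fintype.sum_equiv e _ f (fun _ => rfl), Fintype.sum_prod_type]
  simp only [e, Equiv.coe_fn_mk]
  have hrow : ∀ π : Perm (Fin m),
      ∑ τ : {τ : Fin d → Perm (Fin m) // τ 0 = 1}, f (fun j => π * τ.1 j) =
        ∑ τ : {τ : Fin d → Perm (Fin m) // τ 0 = 1}, f τ.1 := by
    intro π
    exact Finset.sum_congr rfl fun τ _ => hinv π τ.1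
  simp only [hrow, Finset.sum_const, Finset.card_univ, Fintype.card_perm, Fintype.card_fin,
    nsmul_eq_mul]
  congr 1
  exact (Finset.sum_subtype _ (fun σ => by simp) f).symm

/-- **BI 2017 Rem. 3.26, `m = 5`, first reduction**: `latinAnnulusCount 5 6` is `120` times the
signed count of the `5 × 6` Latin annuli (as sextuples of column permutations with bijective
diagonals) whose column `0` is the identity. [cite: BurgisserIkenmeyer2017, Rem. 3.26] -/
theorem latinAnnulusCount_five_six_eq :
    latinAnnulusCount 5 6 =
      120 *
        ∑ σ ∈ (Finset.univ : Finset (Fin 6 → Perm (Fin 5))).filter (fun σ => σ 0 = 1),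
          if ∀ i : Fin 6, Function.Bijective fun κ : Fin 5 =>
              σ ⟨((i : ℕ) + (κ : ℕ)) % 6, Nat.mod_lt _ i.pos⟩ κ
          then ∏ j, ((Kumar2015.seqSign (⇑(σ j)) : ℤˣ) : ℤ) else 0 := by
  rw [latinAnnulusCount_eq_factorial_mul 5 6 (by decide)]
  rfl

end RelabellingSymmetry

end Literature.Computability.AlgebraicComplexity
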